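import Summits.ABC.IUTFork.Repair.RHQ3LTail
import Summits.ABC.IUTFork.Repair.RHHeightClass
import HarnessLib

/-!
# D-0079 RESCUE sub-cell R-H, ROUND 2 Q3 — the l-TAIL of row 8 «heightclass» (`RHHeightClass.HBand`, p459046; Σ₈ = HEX `k ≤ k₀(p,e_w,l)`):
# `k₀(p, e, l) = 2·log_p e + O(1)` as two-sided INTEGER inequalities, and the band at the genuine datum in the tail

Companion of `RHQ3LTail` / `RHQ3LTailHull` / `RHQ3LTailConverse` (seat abc-iut-rh2-q3-typ-1 g0; rung LADDER-ABC:A2.RESCUE.H; rh-lead ROUND2/START-HERE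
§2 «rh2-q3-typ-1: closed-form asymptotics/bounds of k₀ as integer inequalities (k0_le, k0_ge) and «datum(k) ∈ Σ ⇔ l ≥ l₀(k,p,e_w)»»). PROOF-ONLY
(0 definitions). TAKES NO SIDE on [IUTchIII] Cor. 3.12 or on any author; nothing here asserts abc; `HBand`, `StrictMinPow`, `CertVal` are row 8's
CANDIDATE vocabulary (abc-iut-rh-typ-8, consumed BY NAME); «in Σ₈» = the hypothesis H⋆₈ holds as typed, never «S holds».

ROW 8'S CELL (band form, uniform fibre, certified member valuation `r`, untied `r = r♯(p,e) := min_t (p^t − t·e)`): `(j²−1)·m_q ≤ j·(e − r) + (1 − r)`;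
its HEX slice (abc-iut-rh-typ-8 `hexSlice_iff`, `m_q = k·ε`, `e = l·ε = (2l⋆+1)·ε`, top label `j = l⋆` binds by `band_le_of_top`):
`k ≤ k₀(p,e,l) := ⌊l·(l⋆(e−r♯)+1−r♯)/((l⋆²−1)·e)⌋`.
* §1 `strictMinPow_le_pow_sub` (`r♯ ≤ p^t − t·e` for every `t`); `band_of_linear` (`r ≤ p^t − t·e`, `p^t ≤ e`, `(j−1)·m ≤ (t−1)·e ⟹ cell`);
  **`hexSlice_of_k_le` = k0_ge**: `p^t ≤ e ∧ k ≤ 2t ⟹` the top HEX cell holds — `k₀(p,e,l) ≥ 2·⌊log_p e⌋` at EVERY `l`;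
  **`not_hexSlice_of_k_ge` = k0_le**: `−T·e ≤ r ∧ 3T + 4 ≤ l⋆ ∧ 2T + 3 ≤ k ⟹` the top cell FAILS — `k₀(p,e,l) ≤ 2T + 2` once `l⋆ ≥ 3T + 4`, where `T` is any
  integer with `r ≥ −T·e` (for the untied minimum `r♯ = p^{t⋆} − t⋆·e ≥ −t⋆·e`, `T = t⋆` = the minimiser, `p^{t⋆} ≤ t⋆·e + 1`). So
  `2·⌊log_p e⌋ ≤ k₀ ≤ 2·t⋆ + 2`: `k₀ = 2·log_p e + O(1)`, UNBOUNDED along the genuine l-axis `e = e_w = l·ε` — the lead's 19:48:27Z preliminary «k₀ bounded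
  in l» holds only at FIXED `e_w`; «k₀ ~ 2·log_p e_w if e_w grows with l» is the right clause (numerics of record rh2-q3-num 22:08:05Z:
  `l₀⁸(k) ≈ 2^{[k odd]}·7^{⌊k/2⌋}/e_v`; kernel sufficient side here: `e_v·l ≥ 7^{⌈k/2⌉}` ⟹ `λ_k ∈ Σ₈` at the `7`-adic packet).
* §2 at the GENUINE datum `Cor312Prov.pilotDataOfK D K`: `bandIneq_pilotDataOfK_of_ltail` — at a bad place `w | p` with a member valuation
  `r ≤ p^t − t·e_w` (e.g. the untied `r♯`), `p^t ≤ l` and `ord_v(q_v) + 4·e(v|p) ≤ 4·e(v|p)·t`, the band inequality holds at EVERY label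
  (`2l·P_q(w) = e(w|v)·ord_v(q_v)`, `e_w = e(v|p)·e(w|v) ≥ l`); `hBand_pilotDataOfK_of_ltail` — with ramification-UNIFORM fibres and an untied certificate at
  every bad place, `HBand (pilotDataOfK D K)`: the datum is in Σ₈ (hence in Σ₁₅ ⊋ Σ₈, `RHHeightClassGlue`/p460910) for `l ≥ l₀(E)`, `l₀` exponential in the
  local heights exactly as for rows 3/4 (`RHQ3LTail`). Q3(row 8/15 on the l-axis) = YES per curve on uniform untied data; window half = rh2-q3-num's
  numbers (compatible with (P1) iff `k ≤ 23` on HEX).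
[cite: Mochizuki2012, IUTchI Def. 3.1 (c) p. 62, Ex. 3.2 (iv) p. 71; IUTchIV Prop. 1.2 (i)(ii) p. 10, Prop. 1.4 p. 13] [cite: DupuyHilado2025, §3.4, §4.9]
[claim: Mochizuki2012, status: disputed] for every IUT locution.
-/

noncomputable section

open Set Function NumberField IsDedekindDomain

namespace Summit.ABC.IUTFork.Repair.RH.Q3LTailBand

open Literature.IUT.LogThetaLattice Literature.IUT.LogVolume Literature.IUT.HodgeTheaters
open Summit.ABC.IUTFork.Thm311 Summit.ABC.IUTFork.Thm311.Real Summit.ABC.IUTFork.Cor312Prov Summit.ABC.IUTFork.Repair.RHHeightClass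

/-! ## §1. Integer currency: the band cell from a linear test; two-sided bounds on the HEX slice `k₀(p, e, l)` -/

/-- **The untied minimum is below every value**: `StrictMinPow p e r ⟹ r ≤ p^t − t·e` for all `t`. [folklore] -/
theorem strictMinPow_le_pow_sub {p e : ℕ} {r : ℤ} (h : StrictMinPow p e r) (t : ℕ) : r ≤ (p : ℤ) ^ t - t * e := by
  obtain ⟨t₀, ht₀, hmin⟩ := h
  by_cases ht : t = t₀
  · subst ht; exact ht₀.ge
  · exact (hmin t ht).le

/-- **LINEAR SUFFICIENT TEST for the band cell** (integers): `r ≤ p^t − t·e`, `p^t ≤ e`, `0 ≤ e`, `1 ≤ j`, `(j−1)·m ≤ (t−1)·e ⟹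
(j²−1)·m ≤ j·(e − r) + (1 − r)` (`(j²−1)m = (j+1)(j−1)m ≤ (j+1)(t−1)e ≤ (j+1)(t·e − p^t) ≤ (j+1)(−r) ≤ j(e−r) + (1−r)`). [folklore] -/
theorem band_of_linear {p : ℕ} {e m j r : ℤ} {t : ℕ} (he : 0 ≤ e) (hrt : r ≤ (p : ℤ) ^ t - t * e)
    (hpt : (p : ℤ) ^ t ≤ e) (hj : 1 ≤ j) (hlin : (j - 1) * m ≤ ((t : ℤ) - 1) * e) :
    (j ^ 2 - 1) * m ≤ j * (e - r) + (1 - r) := by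
  have hj0 : 0 ≤ j + 1 := by linarith
  have h1 : (j ^ 2 - 1) * m ≤ (j + 1) * (((t : ℤ) - 1) * e) := by nlinarith
  have h2 : (j + 1) * (((t : ℤ) - 1) * e) ≤ (j + 1) * (-r) := mul_le_mul_of_nonneg_left (by linarith) hj0
  nlinarith

/-- **LINEAR REFUTING TEST for the band cell** (integers): if `−T·e ≤ r`, `0 ≤ j` and `j·(e·(T+1)) + T·e + 1 < (j²−1)·m` then the cell FAILS
(`j(e−r) + (1−r) ≤ j·e·(T+1) + T·e + 1`). [folklore] -/
theorem not_band_of_heavy {e m j r T : ℤ} (hj : 0 ≤ j) (hr : -(T * e) ≤ r)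
    (h : j * (e * (T + 1)) + T * e + 1 < (j ^ 2 - 1) * m) :
    ¬ (j ^ 2 - 1) * m ≤ j * (e - r) + (1 - r) := by
  intro hc
  have h1 : j * (e - r) ≤ j * (e * (T + 1)) := mul_le_mul_of_nonneg_left (by linarith) hj
  linarith

/-- **k0_ge — the HEX slice contains `k ≤ 2·⌊log_p e⌋` at EVERY `l`.** In abc-iut-rh-typ-8's slice currency (`hexSlice_iff`: `m_q = k·ε`, top label `l⋆`,
uniform index `e = (2l⋆+1)·ε = l·ε`), with a member valuation `r ≤ 1`, `r ≤ p^t − t·e` (the untied `r♯`, `strictMinPow_le_pow_sub`/`strictMinPow_le_one`)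
and `p^t ≤ e`: `k ≤ 2t ⟹ (l⋆²−1)·(k·ε) ≤ l⋆·(e − r) + (1 − r)`. Hence `k₀(p,e,l) ≥ 2t`: along the genuine l-axis (`e = e_w ≥ l`) the slice bound is
UNBOUNDED, `≥ 2⌊log_p e_w⌋`. [folklore] -/
theorem hexSlice_of_k_le {p : ℕ} {k ε r : ℤ} {ls t : ℕ} (hls : 1 ≤ ls) (hε : 1 ≤ ε) (hk0 : 0 ≤ k) (hr1 : r ≤ 1)
    (hrt : r ≤ (p : ℤ) ^ t - t * ((2 * ls + 1 : ℤ) * ε)) (hpt : (p : ℤ) ^ t ≤ (2 * ls + 1 : ℤ) * ε) (hk : k ≤ 2 * t) :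
    (((ls : ℤ)) ^ 2 - 1) * (k * ε) ≤ (ls : ℤ) * ((2 * ls + 1 : ℤ) * ε - r) + (1 - r) := by
  set e : ℤ := (2 * ls + 1 : ℤ) * ε with he
  have he0 : 0 ≤ e := by positivity
  have hls1 : (1 : ℤ) ≤ ls := by exact_mod_cast hls
  rcases Nat.eq_zero_or_pos t with ht | ht
  · -- `t = 0`: `k = 0`, the cell reads `0 ≤ l⋆(e − r) + (1 − r)`
    subst ht
    have hk' : k = 0 := by omega
    subst hk'
    nlinarith
  have ht1 : (1 : ℤ) ≤ t := by exact_mod_cast ht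
  -- `−r ≥ t·e − p^t ≥ (t−1)·e`
  have hr : ((t : ℤ) - 1) * e ≤ -r := by nlinarith
  -- RHS ≥ l⋆·e + (l⋆+1)(t−1)e ; LHS ≤ (l⋆²−1)·2t·ε
  have hR : (ls : ℤ) * e + ((ls : ℤ) + 1) * (((t : ℤ) - 1) * e) ≤ (ls : ℤ) * (e - r) + (1 - r) := by nlinarith
  have hL : (((ls : ℤ)) ^ 2 - 1) * (k * ε) ≤ (((ls : ℤ)) ^ 2 - 1) * (2 * t * ε) := by
    have : 0 ≤ ((ls : ℤ)) ^ 2 - 1 := by nlinarith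
    exact mul_le_mul_of_nonneg_left (by nlinarith) this
  -- `(l⋆²−1)·2t·ε ≤ l⋆·e + (l⋆+1)(t−1)e` with `e = (2l⋆+1)ε`: difference `= ε·(3l⋆t − 2l⋆ + 3t − 1) ≥ 0`
  have hmid : (((ls : ℤ)) ^ 2 - 1) * (2 * t * ε) ≤ (ls : ℤ) * e + ((ls : ℤ) + 1) * (((t : ℤ) - 1) * e) := by
    rw [he]
    nlinarith [mul_nonneg (sub_nonneg.2 hls1) (sub_nonneg.2 ht1), mul_nonneg (sub_nonneg.2 hε) (sub_nonneg.2 ht1),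
      mul_nonneg (mul_nonneg (sub_nonneg.2 hls1) (sub_nonneg.2 ht1)) (sub_nonneg.2 hε)]
  linarith

/-- **k0_le — above `2T + 2` the HEX slice is EMPTY once `l⋆ ≥ 3T + 4`**, where `T ≥ 0` is any integer with `−T·e ≤ r` (untied: `r♯ = p^{t⋆} − t⋆·e ≥ −t⋆·e`,
`T := t⋆` the minimiser): `2T + 3 ≤ k ⟹ ¬ (l⋆²−1)·(k·ε) ≤ l⋆·(e − r) + (1 − r)`. With `hexSlice_of_k_le`: `2⌊log_p e⌋ ≤ k₀(p,e,l) ≤ 2t⋆ + 2` for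
`l ≥ 6t⋆ + 9` — `k₀ = 2·log_p e + O(1)`. [folklore] -/
theorem not_hexSlice_of_k_ge {k ε r T : ℤ} {ls : ℕ} (hε : 1 ≤ ε) (hT : 0 ≤ T) (hr : -(T * ((2 * ls + 1 : ℤ) * ε)) ≤ r)
    (hls : 3 * T + 4 ≤ (ls : ℤ)) (hk : 2 * T + 3 ≤ k) :
    ¬ (((ls : ℤ)) ^ 2 - 1) * (k * ε) ≤ (ls : ℤ) * ((2 * ls + 1 : ℤ) * ε - r) + (1 - r) := by
  set e : ℤ := (2 * ls + 1 : ℤ) * ε with he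
  have hls0 : (0 : ℤ) ≤ ls := by positivity
  refine not_band_of_heavy hls0 hr ?_
  -- `l⋆·e·(T+1) + T·e + 1 < (l⋆²−1)·k·ε`, using `k ≥ 2T+3`, `e = (2l⋆+1)ε`, `l⋆ ≥ 3T+4`
  have h1 : (((ls : ℤ)) ^ 2 - 1) * ((2 * T + 3) * ε) ≤ (((ls : ℤ)) ^ 2 - 1) * (k * ε) := by
    have : 0 ≤ ((ls : ℤ)) ^ 2 - 1 := by nlinarith
    exact mul_le_mul_of_nonneg_left (by nlinarith) this
  have h2 : (ls : ℤ) * (e * (T + 1)) + T * e + 1 < (((ls : ℤ)) ^ 2 - 1) * ((2 * T + 3) * ε) := by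
    rw [he]
    nlinarith [mul_nonneg hls0 hT, mul_nonneg (sub_nonneg.2 hε) hT, mul_nonneg (sub_nonneg.2 hε) hls0]
  linarith

/-! ## §2. The band at the GENUINE `K`-level datum in the l-tail -/

section Genuine

variable {F K Fbar : Type} [Field F] [NumberField F] [Field K] [NumberField K] [Algebra F K] [Field Fbar]
  [Algebra F Fbar] [Algebra K Fbar] {E : WeierstrassCurve F} [E.IsElliptic] {l : ℕ} {Pb : BadPlacePredicates K}
  (D : InitialThetaData F K Fbar E l Pb)

/-- **ROW 8's BAND INEQUALITY AT A GENUINE CELL IN THE l-TAIL.** At a bad place `w | p` of `pilotDataOfK D K` over `v`, for ANY member valuation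
`r ≤ p^t − t·e_w` (`e_w = e(w|p)`; e.g. the untied `r♯`, `strictMinPow_le_pow_sub`), if `p^t ≤ l` and `ord_v(q_v) + 4·e(v|p) ≤ 4·e(v|p)·t` then at EVERY label
`j = i+1`: `(j²−1)·P_q(w) ≤ j·(e_w − r) + (1 − r)` (reals, `P_q(w) = qPilot`, `e_w = ramIdx K w`). Same integer key as rows 3/4: `i·P_q(w) ≤ (t−1)·e_w` from
`2l·P_q(w) = e(w|v)·ord_v(q_v)`, `e_w = e(v|p)·e(w|v)`, `2i + 3 ≤ l`. [cite: Mochizuki2012, IUTchI Ex. 3.2 (iv) p. 71; IUTchIV Prop. 1.2 (i)(ii) p. 10]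
[claim: Mochizuki2012, status: disputed] -/
theorem bandIneq_pilotDataOfK_of_ltail (pp : Nat.Primes) (i : Fin (pilotDataOfK D K).lstar)
    (w : (thetaIndex (pilotDataOfK D K)).Fibre (.inr pp))
    (hw : haveI : Fact (pp : ℕ).Prime := ⟨pp.2⟩; placeOf (pilotDataOfK D K) pp.1 w ∈ (pilotDataOfK D K).S)
    (t : ℕ) (hpt : (pp : ℕ) ^ t ≤ l)
    (hn : haveI : Fact (pp : ℕ).Prime := ⟨pp.2⟩
      qParamOrd E (finBelow F K (placeOf (pilotDataOfK D K) pp.1 w)) + 4 * ramIdx F (finBelow F K (placeOf (pilotDataOfK D K) pp.1 w)) ≤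
        4 * ramIdx F (finBelow F K (placeOf (pilotDataOfK D K) pp.1 w)) * t)
    (r : ℤ) (hrt : haveI : Fact (pp : ℕ).Prime := ⟨pp.2⟩
      r ≤ ((pp : ℕ) : ℤ) ^ t - t * (ramIdx K (placeOf (pilotDataOfK D K) pp.1 w) : ℤ)) :
    haveI : Fact (pp : ℕ).Prime := ⟨pp.2⟩
    ((((i : ℕ) : ℝ) + 1) ^ 2 - 1) * (pilotDataOfK D K).qPilot (placeOf (pilotDataOfK D K) pp.1 w)
      ≤ (((i : ℕ) : ℝ) + 1) * ((ramIdx K (placeOf (pilotDataOfK D K) pp.1 w) : ℝ) - r) + (1 - r) := by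
  haveI hF : Fact (pp : ℕ).Prime := ⟨pp.2⟩
  set w₀ := placeOf (pilotDataOfK D K) pp.1 w with hw₀
  set v := finBelow F K w₀ with hv
  obtain ⟨P, hP, -, h2lP⟩ := exists_nat_qPilot_pilotDataOfK D hw
  have htower : w₀.asIdeal.ramificationIdx ℤ = ramIdx F v * Ideal.ramificationIdx' v.asIdeal w₀.asIdeal :=
    ThetaData.absRamificationIdx_eq_ramIdx_mul (F := F) w₀
  have hVF : FinitePlace.mk v ∈ D.VFbad := (mem_pilotDataOfK_S_iff D K w₀).mp hw
  have hlr : l ≤ Ideal.ramificationIdx' v.asIdeal w₀.asIdeal := ThetaData.l_le_ramificationIdx_of_under_mem_VFbad D hVF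
  have he0 : 0 < ramIdx F v := Nat.pos_of_ne_zero (ramIdx_ne_zero F v)
  have hi : 2 * (i : ℕ) + 3 ≤ l := by
    have h1 : (i : ℕ) < (pilotDataOfK D K).lstar := i.2
    have h2 : (pilotDataOfK D K).lstar = (l - 1) / 2 := by unfold PilotData.lstar; rw [pilotDataOfK_l]
    omega
  have ht1 : 1 ≤ t := by
    by_contra h0
    have : t = 0 := by omega
    subst this
    omega
  have heq : ramIdx K w₀ = w₀.asIdeal.ramificationIdx ℤ := ramIdx_eq K w₀
  -- integer key inequality `i·P ≤ (t−1)·e(w|p)`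
  have hkey : (i : ℕ) * P ≤ (t - 1) * w₀.asIdeal.ramificationIdx ℤ := by
    have hl0 : 0 < 2 * l := by omega
    refine Nat.le_of_mul_le_mul_left ?_ hl0
    have hn' : qParamOrd E v ≤ 4 * ramIdx F v * (t - 1) := by
      have : 4 * ramIdx F v * (t - 1) = 4 * ramIdx F v * t - 4 * ramIdx F v := by rw [Nat.mul_sub, Nat.mul_one]
      omega
    rw [htower]
    calc 2 * l * ((i : ℕ) * P) = (i : ℕ) * (2 * l * P) := by ring
      _ = (i : ℕ) * (Ideal.ramificationIdx' v.asIdeal w₀.asIdeal * qParamOrd E v) := by rw [h2lP]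
      _ ≤ (i : ℕ) * (Ideal.ramificationIdx' v.asIdeal w₀.asIdeal * (4 * ramIdx F v * (t - 1))) := by gcongr
      _ = (4 * (i : ℕ)) * (ramIdx F v * Ideal.ramificationIdx' v.asIdeal w₀.asIdeal * (t - 1)) := by ring
      _ ≤ (2 * l) * (ramIdx F v * Ideal.ramificationIdx' v.asIdeal w₀.asIdeal * (t - 1)) :=
          Nat.mul_le_mul_right _ (by omega)
      _ = 2 * l * ((t - 1) * (ramIdx F v * Ideal.ramificationIdx' v.asIdeal w₀.asIdeal)) := by ring
  have hepos : 0 < w₀.asIdeal.ramificationIdx ℤ := by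
    rw [htower]; exact Nat.mul_pos he0 (lt_of_lt_of_le (by omega) hlr)
  have hpte : (pp : ℕ) ^ t ≤ w₀.asIdeal.ramificationIdx ℤ := by
    rw [htower]
    calc (pp : ℕ) ^ t ≤ l := hpt
      _ ≤ Ideal.ramificationIdx' v.asIdeal w₀.asIdeal := hlr
      _ ≤ ramIdx F v * Ideal.ramificationIdx' v.asIdeal w₀.asIdeal := Nat.le_mul_of_pos_left _ he0
  -- the integer band via `band_of_linear`, then cast to `ℝ`
  have hkeyZ : (((i : ℕ) : ℤ) + 1 - 1) * (P : ℤ) ≤ ((t : ℤ) - 1) * (w₀.asIdeal.ramificationIdx ℤ : ℤ) := by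
    have h1 : ((i : ℕ) : ℤ) * (P : ℤ) ≤ (((t - 1 : ℕ)) : ℤ) * (w₀.asIdeal.ramificationIdx ℤ : ℤ) := by exact_mod_cast hkey
    have hsub : (((t - 1 : ℕ)) : ℤ) = (t : ℤ) - 1 := by omega
    rw [hsub] at h1
    simpa using h1
  rw [heq] at hrt
  have hband := band_of_linear (p := (pp : ℕ)) (j := ((i : ℕ) : ℤ) + 1) (m := (P : ℤ)) (by positivity) hrt
    (by exact_mod_cast hpte) (by omega) hkeyZ
  rw [hP, heq]
  have hcast : ((((i : ℕ) : ℤ) + 1) ^ 2 - 1 : ℤ) * (P : ℤ) ≤ (((i : ℕ) : ℤ) + 1) * ((w₀.asIdeal.ramificationIdx ℤ : ℤ) - r) + (1 - r) := hband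
  have := (Int.cast_le (R := ℝ)).2 hcast
  push_cast at this
  exact this

/-- **ROW 8 IN THE l-TAIL AT THE GENUINE DATUM.** If every bad place `w | p` of `pilotDataOfK D K` has (i) a ramification-UNIFORM fibre over `p`, (ii) an
UNTIED strict-minimum certificate `r₀(w) = r♯(p, e_w)` (`StrictMinPow`, abc-iut-rh-typ-8's column `r_out_sharp`), and (iii) the l-tail test `p^t ≤ l`,
`ord_v(q_v) + 4·e(v|p) ≤ 4·e(v|p)·t` for some `t`, then `HBand (pilotDataOfK D K)` — the datum lies in Σ₈ (hence in Σ₁₅ ⊇ Σ₈). `p > 2` at bad places is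
[IUTchI] Def. 3.1 (b) (`Cor312Prov.ne_two_and_ne_l_of_placeOf_mem_S_pilotDataOfK`). [cite: Mochizuki2012, IUTchI Def. 3.1 (b)(c) pp. 61–62; IUTchIV Prop. 1.2 p. 10]
[claim: Mochizuki2012, status: disputed] -/
theorem hBand_pilotDataOfK_of_ltail
    (r₀ : ∀ pp : Nat.Primes, (thetaIndex (pilotDataOfK D K)).Fibre (.inr pp) → ℤ)
    (h₀ : ∀ (pp : Nat.Primes) (w : (thetaIndex (pilotDataOfK D K)).Fibre (.inr pp)),
      haveI : Fact (pp : ℕ).Prime := ⟨pp.2⟩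
      placeOf (pilotDataOfK D K) pp.1 w ∈ (pilotDataOfK D K).S →
        StrictMinPow pp (ramIdx K (placeOf (pilotDataOfK D K) pp.1 w)) (r₀ pp w))
    (hunif : ∀ (pp : Nat.Primes) (w w' : (thetaIndex (pilotDataOfK D K)).Fibre (.inr pp)),
      haveI : Fact (pp : ℕ).Prime := ⟨pp.2⟩
      placeOf (pilotDataOfK D K) pp.1 w ∈ (pilotDataOfK D K).S →
        ramIdx K (placeOf (pilotDataOfK D K) pp.1 w') = ramIdx K (placeOf (pilotDataOfK D K) pp.1 w))
    (htail : ∀ (pp : Nat.Primes) (w : (thetaIndex (pilotDataOfK D K)).Fibre (.inr pp)),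
      haveI : Fact (pp : ℕ).Prime := ⟨pp.2⟩
      placeOf (pilotDataOfK D K) pp.1 w ∈ (pilotDataOfK D K).S →
        ∃ t : ℕ, (pp : ℕ) ^ t ≤ l ∧
          qParamOrd E (finBelow F K (placeOf (pilotDataOfK D K) pp.1 w)) + 4 * ramIdx F (finBelow F K (placeOf (pilotDataOfK D K) pp.1 w)) ≤
            4 * ramIdx F (finBelow F K (placeOf (pilotDataOfK D K) pp.1 w)) * t) :
    HBand (pilotDataOfK D K) := by
  intro pp i w hw
  haveI hF : Fact (pp : ℕ).Prime := ⟨pp.2⟩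
  have hp2 : 2 < (pp : ℕ) := by
    have h := (ne_two_and_ne_l_of_placeOf_mem_S_pilotDataOfK D pp w hw).1
    have := pp.2.two_le
    omega
  obtain ⟨t, hpt, hn⟩ := htail pp w hw
  refine ⟨hp2, fun w' => hunif pp w w' hw, r₀ pp w, Or.inl (h₀ pp w hw), ?_⟩
  exact bandIneq_pilotDataOfK_of_ltail D pp i w hw t hpt hn (r₀ pp w) (strictMinPow_le_pow_sub (h₀ pp w hw) t)

end Genuine

end Summit.ABC.IUTFork.Repair.RH.Q3LTailBand

end
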